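import Literature.AnabelianGeometry.SemiGraphs.PSCThm16iiGeneralSigmaProofs
import Literature.AnabelianGeometry.SemiGraphs.PSCThm16iiiHypothesisFreeProofs
import Literature.AnabelianGeometry.SemiGraphs.PSCSeparatingCoveringsProofs2
import HarnessLib

/-!
# [CombGC] Theorem 1.6 (i)(ii)(iii) AS TYPED — one closer from the origin statements (capstone)

Mochizuki, *A combinatorial version of the Grothendieck conjecture*, Tohoku Math. J. **59** (2007)
[CombGC], Theorem 1.6 (Criterion for graphicity), author's ms p. 13: for `G`, `H` semi-graphs of
anabelioids of pro-`Σ` PSC-type and `α : Π_G ⥲ Π_H` (resp. `β : Π^unr_G ⥲ Π^unr_H` for `G`, `H` sturdy):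
"(i) `α` is numerically cuspidal if and only if it is group-theoretically cuspidal. (ii) `α` is graphic
if and only if it is graphically filtration-preserving. (iii) `β` is verticially filtration-preserving
if and only if it is group-theoretically verticial."

Sub-DAG `plan/L3/SUBDAG-CombGC-Thm16.md`, row T16-CAPSTONE (node CombGC:Thm1.6; FACT-LIST rows F-0458
`NumericallyCuspidalIffHolds`, F-0444 `GraphicIffFiltrationPreservingHolds`, F-0461 `UnrVerticialIffHolds`
— abc-iut-L3-t4's typings in `PSCGraphicity.lean`, quantified over all data of an origin `Ω`).  The
three legs are in the tree, each for EVERY `Σ` and with no displayed side binder besides profiniteness: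
(i) `numericallyCuspidalIff_holds_of_inputs` (`PSCCommonPrimeProofs.lean`, abc-iut-w5-d183), (ii)
`graphicIffFiltrationPreservingHolds_of_inputs''` (`PSCThm16iiGeneralSigmaProofs.lean`, abc-iut-w5-d174;
shadow graphicity on the pro-`l` images of the sturdy levels), (iii) `unrVerticialIffHolds_of_inputs''`
(`PSCThm16iiiHypothesisFreeProofs.lean`, abc-iut-w5-d183 over abc-iut-w4-d052's pro-`l` shadow route on
`Π^unr`-levels).  This proof-only file only COMPOSES them:

* **`thm16_holds_of_inputs`** — `NumericallyCuspidalIffHolds Ω ∧ GraphicIffFiltrationPreservingHolds Ω ∧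
  UnrVerticialIffHolds Ω` for every origin `Ω` whose data live on profinite groups (displayed `hprof`;
  the interface's `proSigma` field constrains finite quotients only) and satisfy the THIRTEEN origin
  statements BY NAME (the union of the legs' inputs is the input list of (ii)): [CombGC] Rmk. 1.1.3 /
  Prop. 1.3 ranks `RankStatementsHold` (F-3098), [IUTchI] Rmk. 1.2.3 (iv) cuspidal and nodal parts
  `CuspidalEdgeLikeCharacterizationHolds` (F-1931) / `NodalEdgeLikeCharacterizationHolds`, Rmk. 1.1.6
  `CompactifyOfPSCTypeHolds`, coverings `RestrictBDOfPSCTypeHolds`, Rmk. 1.1.5 `SturdyCoverHolds`,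
  Prop. 1.2 (i) `OpenInterDeterminesComponentHolds` (F-0459), Prop. 1.2 (ii)
  `CommensurableTerminalityHolds` (F-0438), Prop. 1.5 (ii) `GraphicIffEdgeLikeVerticialHolds`, the
  corrected [IUTchI] Rmk. 1.2.3 (iv) unramified part `UnrVerticialCharacterizationHolds'`, Rmk. 1.1.5 rank
  `UnrVertAbOfRankHolds` (F-3235), connectedness `VertCountLeNodeCountSuccHolds`, pro-`l` completions
  `MapAlongProLOfPSCTypeHolds`;
* **`thm16_holds_of_separating`** — the same with Prop. 1.2 (i)(ii) replaced by their common source, the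
  separating-coverings statement `SeparatingCoveringsHolds` (sub-DAG `SUBDAG-CombGC-Prop12.md` row P12-L00:
  `openInterDeterminesComponentHolds_of_separating`, `commensurableTerminalityHolds_of_separating`,
  abc-iut-w5-d183): TWELVE origin statements + profiniteness;
* `thm16_i_ii_iii_of_inputs` — the three typed iff-statements at one triple `G`, `H`, `α` / `β`.

Proof-only (0 defs); every input is an origin statement consumed by name — a FACT row is an assumption
label, nothing here asserts the printed claims for curves; typed ≠ proved for the origin statements
themselves; nothing here takes a side on [IUTchIII] Cor. 3.12. [cite: MochizukiCombGC2007, Thm 1.6 p.13]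
[cite: MochizukiCombGC2007, Prop 1.2 p.8] [cite: MochizukiCombGC2007, Def 1.1(ii) p.6]
-/

noncomputable section

namespace Literature.AnabelianGeometry.SemiGraphs

namespace PSCDatum

universe u

section Capstone

variable (Ω : PSCOrigin.{u})

/-- **[CombGC] Theorem 1.6 AS TYPED, (i) ∧ (ii) ∧ (iii), from the thirteen origin statements.**  For
every origin `Ω` with profinite data (`hprof`) satisfying, BY NAME, `RankStatementsHold`,
`CuspidalEdgeLikeCharacterizationHolds`, `NodalEdgeLikeCharacterizationHolds`, `CompactifyOfPSCTypeHolds`,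
`RestrictBDOfPSCTypeHolds`, `SturdyCoverHolds`, `OpenInterDeterminesComponentHolds`,
`CommensurableTerminalityHolds`, `GraphicIffEdgeLikeVerticialHolds`, `UnrVerticialCharacterizationHolds'`,
`UnrVertAbOfRankHolds`, `VertCountLeNodeCountSuccHolds`, `MapAlongProLOfPSCTypeHolds`: "(i) `α` is
numerically cuspidal iff group-theoretically cuspidal; (ii) `α` is graphic iff graphically
filtration-preserving; (iii) [for `G`, `H` sturdy] `β` is verticially filtration-preserving iff
group-theoretically verticial" (p. 13) — for ALL `G`, `H` of `Ω`-type, every `Σ_G`, `Σ_H`, every `α`,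
`β`.  Legs: `numericallyCuspidalIff_holds_of_inputs` (i), `graphicIffFiltrationPreservingHolds_of_inputs''`
(ii), `unrVerticialIffHolds_of_inputs''` (iii). [cite: MochizukiCombGC2007, Thm 1.6 p.13] -/
theorem thm16_holds_of_inputs
    (hprof : ∀ ⦃Q : Type u⦄ [Group Q] [TopologicalSpace Q] [IsTopologicalGroup Q] (K : PSCDatum Q),
      Ω.IsOfPSCType K → CompactSpace Q ∧ TotallyDisconnectedSpace Q)
    (hrank : RankStatementsHold Ω) (hcusp : CuspidalEdgeLikeCharacterizationHolds Ω)
    (hnodal : NodalEdgeLikeCharacterizationHolds Ω) (hcpt : CompactifyOfPSCTypeHolds Ω)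
    (hres : RestrictBDOfPSCTypeHolds Ω) (hcover : SturdyCoverHolds Ω)
    (hopen : OpenInterDeterminesComponentHolds Ω) (hCT : CommensurableTerminalityHolds Ω)
    (hP15 : GraphicIffEdgeLikeVerticialHolds Ω) (hunr : UnrVerticialCharacterizationHolds' Ω)
    (hrankv : UnrVertAbOfRankHolds Ω) (hconn : VertCountLeNodeCountSuccHolds Ω)
    (hmap : MapAlongProLOfPSCTypeHolds Ω) :
    Literature.AnabelianGeometry.SemiGraphs.PSCDatum.NumericallyCuspidalIffHolds Ω ∧
      Literature.AnabelianGeometry.SemiGraphs.PSCDatum.GraphicIffFiltrationPreservingHolds Ω ∧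
        Literature.AnabelianGeometry.SemiGraphs.PSCDatum.UnrVerticialIffHolds Ω :=
  ⟨numericallyCuspidalIff_holds_of_inputs Ω hprof hCT hopen hcusp hres hmap,
    graphicIffFiltrationPreservingHolds_of_inputs'' Ω hprof hrank hcusp hnodal hcpt hres hcover hopen hCT
      hP15 hunr hrankv hconn hmap,
    unrVerticialIffHolds_of_inputs'' Ω hprof hrank hconn hunr hrankv hres hmap hopen⟩

/-- **[CombGC] Theorem 1.6 AS TYPED, (i) ∧ (ii) ∧ (iii), from TWELVE origin statements** — as
`thm16_holds_of_inputs`, with Prop. 1.2 (i) `OpenInterDeterminesComponentHolds` and Prop. 1.2 (ii)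
`CommensurableTerminalityHolds` replaced by their common source, the separating-coverings statement
`SeparatingCoveringsHolds` ([CombGC] p. 9: "… we may replace 'open in' by 'equal to' …"; sub-DAG row
P12-L00: `openInterDeterminesComponentHolds_of_separating`, `commensurableTerminalityHolds_of_separating`).
[cite: MochizukiCombGC2007, Thm 1.6 p.13] [cite: MochizukiCombGC2007, Prop 1.2 p.8] -/
theorem thm16_holds_of_separating
    (hprof : ∀ ⦃Q : Type u⦄ [Group Q] [TopologicalSpace Q] [IsTopologicalGroup Q] (K : PSCDatum Q),
      Ω.IsOfPSCType K → CompactSpace Q ∧ TotallyDisconnectedSpace Q)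
    (hsep : SeparatingCoveringsHolds Ω)
    (hrank : RankStatementsHold Ω) (hcusp : CuspidalEdgeLikeCharacterizationHolds Ω)
    (hnodal : NodalEdgeLikeCharacterizationHolds Ω) (hcpt : CompactifyOfPSCTypeHolds Ω)
    (hres : RestrictBDOfPSCTypeHolds Ω) (hcover : SturdyCoverHolds Ω)
    (hP15 : GraphicIffEdgeLikeVerticialHolds Ω) (hunr : UnrVerticialCharacterizationHolds' Ω)
    (hrankv : UnrVertAbOfRankHolds Ω) (hconn : VertCountLeNodeCountSuccHolds Ω)
    (hmap : MapAlongProLOfPSCTypeHolds Ω) :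
    Literature.AnabelianGeometry.SemiGraphs.PSCDatum.NumericallyCuspidalIffHolds Ω ∧
      Literature.AnabelianGeometry.SemiGraphs.PSCDatum.GraphicIffFiltrationPreservingHolds Ω ∧
        Literature.AnabelianGeometry.SemiGraphs.PSCDatum.UnrVerticialIffHolds Ω :=
  thm16_holds_of_inputs Ω hprof hrank hcusp hnodal hcpt hres hcover
    (openInterDeterminesComponentHolds_of_separating Ω hsep hprof)
    (commensurableTerminalityHolds_of_separating Ω hsep hprof) hP15 hunr hrankv hconn hmap

/-- **[CombGC] Theorem 1.6 at one triple**: for `G`, `H` of `Ω`-type (any `Σ_G`, `Σ_H`), any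
`α : Π_G ⥲ Π_H` and any `β : Π^unr_G ⥲ Π^unr_H`, the three typed statements
`NumericallyCuspidalIffGroupTheoreticallyCuspidal G H α`, `GraphicIffGraphicallyFiltrationPreserving G H α`,
`UnrVerticiallyFiltrationPreservingIffVerticial G H β` — from the thirteen origin statements and
profiniteness. [cite: MochizukiCombGC2007, Thm 1.6 p.13] -/
theorem thm16_i_ii_iii_of_inputs
    (hprof : ∀ ⦃Q : Type u⦄ [Group Q] [TopologicalSpace Q] [IsTopologicalGroup Q] (K : PSCDatum Q),
      Ω.IsOfPSCType K → CompactSpace Q ∧ TotallyDisconnectedSpace Q)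
    (hrank : RankStatementsHold Ω) (hcusp : CuspidalEdgeLikeCharacterizationHolds Ω)
    (hnodal : NodalEdgeLikeCharacterizationHolds Ω) (hcpt : CompactifyOfPSCTypeHolds Ω)
    (hres : RestrictBDOfPSCTypeHolds Ω) (hcover : SturdyCoverHolds Ω)
    (hopen : OpenInterDeterminesComponentHolds Ω) (hCT : CommensurableTerminalityHolds Ω)
    (hP15 : GraphicIffEdgeLikeVerticialHolds Ω) (hunr : UnrVerticialCharacterizationHolds' Ω)
    (hrankv : UnrVertAbOfRankHolds Ω) (hconn : VertCountLeNodeCountSuccHolds Ω)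
    (hmap : MapAlongProLOfPSCTypeHolds Ω)
    ⦃Q : Type u⦄ [Group Q] [TopologicalSpace Q] [IsTopologicalGroup Q]
    ⦃Q' : Type u⦄ [Group Q'] [TopologicalSpace Q'] [IsTopologicalGroup Q']
    {G : PSCDatum Q} {H : PSCDatum Q'} (hGΩ : Ω.IsOfPSCType G) (hHΩ : Ω.IsOfPSCType H)
    (α : Q ≃ₜ* Q') (β : (Q ⧸ G.unrKer) ≃ₜ* (Q' ⧸ H.unrKer)) :
    G.NumericallyCuspidalIffGroupTheoreticallyCuspidal H α ∧
      G.GraphicIffGraphicallyFiltrationPreserving H α ∧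
        G.UnrVerticiallyFiltrationPreservingIffVerticial H β := by
  obtain ⟨h1, h2, h3⟩ := thm16_holds_of_inputs Ω hprof hrank hcusp hnodal hcpt hres hcover hopen hCT
    hP15 hunr hrankv hconn hmap
  exact ⟨h1 G H α hGΩ hHΩ, h2 G H α hGΩ hHΩ, h3 G H β hGΩ hHΩ⟩

end Capstone

end PSCDatum

end Literature.AnabelianGeometry.SemiGraphs
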